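import Literature.Probability.Percolation.SelfRefinementMeasure
import Literature.Probability.Percolation.KohlerSchindlerTassionRSW
import Summits.CriticalPhenomena.CardyFormulaZ2.Theorems.CardySelfRefinementCriticalPathRSWStubCone3LargeA
import Summits.CriticalPhenomena.CardyFormulaZ2.Theorems.CardySelfRefinementCriticalPathRSWStubCone3LocalD

/-!
# Stub `stub_cone3` of line `finite-size-envelope` (crux `CriticalPathRSW`), part 13:
the atoms at `w` and in the middle; the total atom bound (interior density `c ≥ 1/10`)

Support file for item `stmt-CriticalPhenomena-10267` (stub `stub_cone3`).  For the tuple `(b, d)`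
inside the box `[-3n, 3n] × [-9n, 9n]` (not inside a side), the event that some single sub-edge
is an **atom** — with the tuple closed the sides are not joined, with that sub-edge alone opened
they are — has probability at most `240000 · Σ_{g ∈ Π} P(g pivotal)` (`Cone3.real_atom_le`;
this part: the atoms at `w` and in the middle, part 12: the atom at `u`), where `Π` is the list of
the eighteen interior labels next to the tuple used by the walks and `c ≥ 1/10` bounds the cost
of opening at most three of them.  The bound is uniform in the tying parameter `ρ ∈ [0, 1]`.

References: Aizenman–Grimmett 1991 §3; Grimmett 1999 §2.4.
-/

noncomputable section

namespace Summit.CriticalPhenomena.CardyFormulaZ2.Cruxes.CriticalPathRSW.FiniteSizeEnvelope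

open Set MeasureTheory
open Literature.Probability.LatticeModels Literature.Probability.Percolation

namespace Cone3

variable {n : ℕ} {ρ c : ℝ} {b : Site 2} {d d' : Fin 2}

set_option quotPrecheck false

/-- The local frame of the tuple `(b, d)`: `pt⟪α, β⟫ = 3b + α e_d + β e_{d'}`. -/
local notation "pt⟪" α ", " β "⟫" =>
  ((3 : ℤ) • b + (α : ℤ) • (Pi.single d (1 : ℤ) : Site 2) + (β : ℤ) • (Pi.single d' (1 : ℤ) : Site 2))

/-- The open labels of a coin configuration. -/
local notation "Op⟪" S "⟫" => {e : Site 2 × Fin 2 | RefinementOpen 3 S e}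

/-- Crossing of the box by a label configuration. -/
local notation "Cr⟪" V "⟫" => (edgeConfig V ∈ KST2023.crossing (3 * n) (3 * (3 * n)))

/-- The override event: close `C`, open `A`, and ask for a left-right crossing of the box. -/
local notation "Z⟪" C ", " A "⟫" =>
  {S : Set (Site 2 × Fin 2 × Fin 3) |
    edgeConfig ((Op⟪S⟫ \ C) ∪ A) ∈ KST2023.crossing (3 * n) (3 * (3 * n))}

/-- The three sub-edges of the tuple. -/
local notation "Tl" =>
  ({(pt⟪0, 0⟫, d), (pt⟪1, 0⟫, d), (pt⟪2, 0⟫, d)} : Set (Site 2 × Fin 2))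

/-- The box. -/
local notation "Bx" => (KST2023.box (3 * n) (3 * (3 * n)))

/-- Its left side. -/
local notation "Lx" => {x : Site 2 | x ∈ KST2023.box (3 * n) (3 * (3 * n)) ∧ x 0 = -((3 * n : ℕ) : ℤ)}

/-- Its right side. -/
local notation "Rx" => {x : Site 2 | x ∈ KST2023.box (3 * n) (3 * (3 * n)) ∧ x 0 = ((3 * n : ℕ) : ℤ)}

/-- Pivotality of the own coin of the interior label `g`. -/
local notation "Piv⟪" g "⟫" =>
  ({S : Set (Site 2 × Fin 2 × Fin 3) |
      edgeConfig ((Op⟪S⟫ \ {g}) ∪ {g}) ∈ KST2023.crossing (3 * n) (3 * (3 * n))} \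
    {S : Set (Site 2 × Fin 2 × Fin 3) |
      edgeConfig ((Op⟪S⟫ \ {g}) ∪ ∅) ∈ KST2023.crossing (3 * n) (3 * (3 * n))})

/-- The walk event: tuple closed, `O` open, `g` pivotal. -/
local notation "Wev⟪" O ", " g "⟫" => (Z⟪{g} ∪ Tl, {g} ∪ ↑O⟫ \ Z⟪{g} ∪ Tl, ∅ ∪ ↑O⟫)

/-- The eighteen interior labels next to the tuple used by the walks. -/
local notation "Πf" =>
  ({(pt⟪0, 1⟫, d), (pt⟪1, 0⟫, d'), (pt⟪-1, 0⟫, d'), (pt⟪-1, 1⟫, d), (pt⟪2, 1⟫, d), (pt⟪2, 0⟫, d'),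
    (pt⟪4, 0⟫, d'), (pt⟪3, 1⟫, d), (pt⟪1, 1⟫, d),
    (pt⟪0, -1⟫, d), (pt⟪1, -1⟫, d'), (pt⟪-1, -1⟫, d'), (pt⟪-1, -1⟫, d), (pt⟪2, -1⟫, d), (pt⟪2, -1⟫, d'),
    (pt⟪4, -1⟫, d'), (pt⟪3, -1⟫, d), (pt⟪1, -1⟫, d)} : Finset (Site 2 × Fin 2))

/-- The coin law. -/
local notation "P" => (prodBernoulli (refinementParam 3 ρ c))

/-! ### The atom at `w` and the middle atom -/

/-- **The atom at `w`.** -/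
theorem real_atom_w_le (hd : d' ≠ d) (hρ0 : 0 ≤ ρ) (hρ1 : ρ ≤ 1) (hc : 1 / 10 ≤ c) (hc1 : c ≤ 1)
    (hbox : ∀ j : ℤ, 0 ≤ j → j ≤ 3 → pt⟪j, 0⟫ ∈ Bx) (hrow : pt⟪0, 1⟫ ∈ Bx ∨ pt⟪0, -1⟫ ∈ Bx)
    (hwL : pt⟪3, 0⟫ ∉ Lx)
    (hwR : pt⟪3, 0⟫ ∈ Rx → ∀ s : ℤ, (s = 1 ∨ s = -1) → pt⟪3, s⟫ ∈ Bx → pt⟪3, s⟫ ∈ Rx) :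
    (P).real (Z⟪Tl, {(pt⟪2, 0⟫, d)}⟫ \ Z⟪Tl, (∅ : Set (Site 2 × Fin 2))⟫) ≤
      12 * 8000 * ∑ g' ∈ Πf, (P).real Piv⟪g'⟫ := by
  set PS := ∑ g' ∈ Πf, (P).real Piv⟪g'⟫ with hPS
  have hPS0 : 0 ≤ PS := Finset.sum_nonneg fun _ _ => measureReal_nonneg
  -- the twelve walk events, for the two rows
  have key : ∀ S ∈ Z⟪Tl, {(pt⟪2, 0⟫, d)}⟫ \ Z⟪Tl, (∅ : Set (Site 2 × Fin 2))⟫,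
      ∃ t : ℤ, (t = 0 ∨ t = -1) ∧
        (S ∈ Wev⟪(∅ : Finset (Site 2 × Fin 2)), (pt⟪2, 2 * t + 1⟫, d)⟫ ∨
          S ∈ Wev⟪({(pt⟪2, 2 * t + 1⟫, d)} : Finset (Site 2 × Fin 2)), (pt⟪2, t⟫, d')⟫ ∨
          S ∈ Wev⟪(∅ : Finset (Site 2 × Fin 2)), (pt⟪4, t⟫, d')⟫ ∨
          S ∈ Wev⟪({(pt⟪4, t⟫, d')} : Finset (Site 2 × Fin 2)), (pt⟪3, 2 * t + 1⟫, d)⟫ ∨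
          S ∈ Wev⟪({(pt⟪4, t⟫, d'), (pt⟪3, 2 * t + 1⟫, d)} : Finset (Site 2 × Fin 2)), (pt⟪2, 2 * t + 1⟫, d)⟫ ∨
          S ∈ Wev⟪({(pt⟪4, t⟫, d'), (pt⟪3, 2 * t + 1⟫, d), (pt⟪2, 2 * t + 1⟫, d)} : Finset (Site 2 × Fin 2)),
            (pt⟪2, t⟫, d')⟫) := by
    rintro S ⟨hyes, hno⟩
    have hno' : ¬ Cr⟪Op⟪S⟫ \ Tl⟫ := by
      intro h; apply hno
      show Cr⟪(Op⟪S⟫ \ Tl) ∪ ∅⟫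
      rw [Set.union_empty]; exact h
    have hT2 : (pt⟪2, 0⟫, d) ∉ Op⟪S⟫ \ Tl := fun h => h.2 (Or.inr (Or.inr rfl))
    obtain ⟨t, s, ht, hs, hdisj⟩ := atom_w hd (V := Op⟪S⟫ \ Tl) hT2 hbox hrow hwL hwR hno' hyes
    subst hs
    refine ⟨t, ht, ?_⟩
    rcases hdisj with ⟨h1, h2⟩ | ⟨h1, h2⟩ | ⟨h1, h2⟩ | ⟨h1, h2⟩ | ⟨h1, h2⟩ | ⟨h1, h2⟩
    · exact Or.inl (mem_walkEvent h1 h2 sub0 sub0')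
    · exact Or.inr (Or.inl (mem_walkEvent h1 h2 sub1 sub1'))
    · exact Or.inr (Or.inr (Or.inl (mem_walkEvent h1 h2 sub0 sub0')))
    · exact Or.inr (Or.inr (Or.inr (Or.inl (mem_walkEvent h1 h2 sub1 sub1'))))
    · exact Or.inr (Or.inr (Or.inr (Or.inr (Or.inl (mem_walkEvent h1 h2 sub2 sub2')))))
    · exact Or.inr (Or.inr (Or.inr (Or.inr (Or.inr (mem_walkEvent h1 h2 sub3 sub3')))))
  -- each walk event costs at most `8000 PS`
  have bound : ∀ t : ℤ, (t = 0 ∨ t = -1) →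
      (P).real (Wev⟪(∅ : Finset (Site 2 × Fin 2)), (pt⟪2, 2 * t + 1⟫, d)⟫) ≤ 8000 * PS ∧
      (P).real (Wev⟪({(pt⟪2, 2 * t + 1⟫, d)} : Finset (Site 2 × Fin 2)), (pt⟪2, t⟫, d')⟫) ≤ 8000 * PS ∧
      (P).real (Wev⟪(∅ : Finset (Site 2 × Fin 2)), (pt⟪4, t⟫, d')⟫) ≤ 8000 * PS ∧
      (P).real (Wev⟪({(pt⟪4, t⟫, d')} : Finset (Site 2 × Fin 2)), (pt⟪3, 2 * t + 1⟫, d)⟫) ≤ 8000 * PS ∧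
      (P).real (Wev⟪({(pt⟪4, t⟫, d'), (pt⟪3, 2 * t + 1⟫, d)} : Finset (Site 2 × Fin 2)), (pt⟪2, 2 * t + 1⟫, d)⟫) ≤
        8000 * PS ∧
      (P).real (Wev⟪({(pt⟪4, t⟫, d'), (pt⟪3, 2 * t + 1⟫, d), (pt⟪2, 2 * t + 1⟫, d)} : Finset (Site 2 × Fin 2)),
        (pt⟪2, t⟫, d')⟫) ≤ 8000 * PS := by
    intro t ht
    have h3 : ¬ (3 : ℤ) ∣ 2 * t + 1 := by rcases ht with rfl | rfl <;> decide
    have h2' : ¬ (3 : ℤ) ∣ 2 := by decide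
    have h4' : ¬ (3 : ℤ) ∣ 4 := by decide
    have ha := not_axial_d (b := b) hd 2 h3
    have hf := not_axial_d' (b := b) hd t h2'
    have hc' := not_axial_d' (b := b) hd t h4'
    have he := not_axial_d (b := b) hd 3 h3
    have memPi : ∀ g : Site 2 × Fin 2,
        (g = (pt⟪2, 2 * t + 1⟫, d) ∨ g = (pt⟪2, t⟫, d') ∨ g = (pt⟪4, t⟫, d') ∨ g = (pt⟪3, 2 * t + 1⟫, d)) →
        g ∈ Πf := by
      intro g hg
      rcases ht with rfl | rfl <;>
        simp only [show (2 : ℤ) * 0 + 1 = 1 by norm_num, show (2 : ℤ) * (-1) + 1 = -1 by norm_num] at hg <;>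
        rcases hg with rfl | rfl | rfl | rfl <;>
        simp only [Finset.mem_insert, Finset.mem_singleton, true_or, or_true]
    have one : ∀ {O : Finset (Site 2 × Fin 2)} {g : Site 2 × Fin 2}, (∀ ℓ ∈ O, ¬ IsAxialEdge 3 ℓ) →
        O.card ≤ 3 → g ∉ O →
        (g = (pt⟪2, 2 * t + 1⟫, d) ∨ g = (pt⟪2, t⟫, d') ∨ g = (pt⟪4, t⟫, d') ∨ g = (pt⟪3, 2 * t + 1⟫, d)) →
        (P).real Wev⟪O, g⟫ ≤ 8000 * PS :=
      fun hO hO3 hgO hg => real_walkEvent_le_sum hd hρ0 hρ1 hc hc1 hO hO3 hgO (memPi _ hg)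
    -- distinctness of the four labels
    have hfa : (pt⟪2, t⟫, d') ≠ (pt⟪2, 2 * t + 1⟫, d) := (lab_ne_of_dir hd _ _ _ _).symm
    have hfc : (pt⟪2, t⟫, d') ≠ (pt⟪4, t⟫, d') := by rw [Ne, lab_eq_iff hd]; omega
    have hfe : (pt⟪2, t⟫, d') ≠ (pt⟪3, 2 * t + 1⟫, d) := (lab_ne_of_dir hd _ _ _ _).symm
    have hec : (pt⟪3, 2 * t + 1⟫, d) ≠ (pt⟪4, t⟫, d') := lab_ne_of_dir hd _ _ _ _
    have hac : (pt⟪2, 2 * t + 1⟫, d) ≠ (pt⟪4, t⟫, d') := lab_ne_of_dir hd _ _ _ _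
    have hae : (pt⟪2, 2 * t + 1⟫, d) ≠ (pt⟪3, 2 * t + 1⟫, d) := by rw [Ne, lab_eq_iff hd]; omega
    refine ⟨?_, ?_, ?_, ?_, ?_, ?_⟩
    · exact one (by simp) (by simp) (by simp) (Or.inl rfl)
    · refine one (fun ℓ hℓ => ?_) (by simp) (by rwa [Finset.mem_singleton]) (Or.inr (Or.inl rfl))
      rw [Finset.mem_singleton] at hℓ; rw [hℓ]; exact ha
    · exact one (by simp) (by simp) (by simp) (Or.inr (Or.inr (Or.inl rfl)))
    · refine one (fun ℓ hℓ => ?_) (by simp) (by rwa [Finset.mem_singleton]) (Or.inr (Or.inr (Or.inr rfl)))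
      rw [Finset.mem_singleton] at hℓ; rw [hℓ]; exact hc'
    · refine one (fun ℓ hℓ => ?_) (Finset.card_le_two.trans (by norm_num)) ?_ (Or.inl rfl)
      · rw [Finset.mem_insert, Finset.mem_singleton] at hℓ
        rcases hℓ with rfl | rfl
        · exact hc'
        · exact he
      · rw [Finset.mem_insert, Finset.mem_singleton, not_or]; exact ⟨hac, hae⟩
    · refine one (fun ℓ hℓ => ?_) Finset.card_le_three ?_ (Or.inr (Or.inl rfl))
      · rw [Finset.mem_insert, Finset.mem_insert, Finset.mem_singleton] at hℓ
        rcases hℓ with rfl | rfl | rfl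
        · exact hc'
        · exact he
        · exact ha
      · rw [Finset.mem_insert, Finset.mem_insert, Finset.mem_singleton, not_or, not_or]; exact ⟨hfc, hfe, hfa⟩
  -- union bound over the twelve events
  have hcover : Z⟪Tl, {(pt⟪2, 0⟫, d)}⟫ \ Z⟪Tl, (∅ : Set (Site 2 × Fin 2))⟫ ⊆
      (⋃ t ∈ ({0, -1} : Finset ℤ),
        (Wev⟪(∅ : Finset (Site 2 × Fin 2)), (pt⟪2, 2 * t + 1⟫, d)⟫ ∪
          Wev⟪({(pt⟪2, 2 * t + 1⟫, d)} : Finset (Site 2 × Fin 2)), (pt⟪2, t⟫, d')⟫ ∪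
          Wev⟪(∅ : Finset (Site 2 × Fin 2)), (pt⟪4, t⟫, d')⟫ ∪
          Wev⟪({(pt⟪4, t⟫, d')} : Finset (Site 2 × Fin 2)), (pt⟪3, 2 * t + 1⟫, d)⟫ ∪
          Wev⟪({(pt⟪4, t⟫, d'), (pt⟪3, 2 * t + 1⟫, d)} : Finset (Site 2 × Fin 2)), (pt⟪2, 2 * t + 1⟫, d)⟫ ∪
          Wev⟪({(pt⟪4, t⟫, d'), (pt⟪3, 2 * t + 1⟫, d), (pt⟪2, 2 * t + 1⟫, d)} : Finset (Site 2 × Fin 2)),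
            (pt⟪2, t⟫, d')⟫)) := by
    intro S hS
    obtain ⟨t, ht, h⟩ := key S hS
    simp only [Set.mem_iUnion, Finset.mem_insert, Finset.mem_singleton, exists_prop]
    refine ⟨t, ht, ?_⟩
    rcases h with h | h | h | h | h | h
    · exact Or.inl (Or.inl (Or.inl (Or.inl (Or.inl h))))
    · exact Or.inl (Or.inl (Or.inl (Or.inl (Or.inr h))))
    · exact Or.inl (Or.inl (Or.inl (Or.inr h)))
    · exact Or.inl (Or.inl (Or.inr h))
    · exact Or.inl (Or.inr h)
    · exact Or.inr h
  refine (measureReal_mono hcover (measure_ne_top _ _)).trans ?_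
  refine (measureReal_biUnion_finset_le _ _).trans ?_
  have h01 : (0 : ℤ) ≠ -1 := by decide
  rw [Finset.sum_insert (by simp [h01]), Finset.sum_singleton]
  have six : ∀ t : ℤ, (t = 0 ∨ t = -1) →
      (P).real (Wev⟪(∅ : Finset (Site 2 × Fin 2)), (pt⟪2, 2 * t + 1⟫, d)⟫ ∪
          Wev⟪({(pt⟪2, 2 * t + 1⟫, d)} : Finset (Site 2 × Fin 2)), (pt⟪2, t⟫, d')⟫ ∪
          Wev⟪(∅ : Finset (Site 2 × Fin 2)), (pt⟪4, t⟫, d')⟫ ∪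
          Wev⟪({(pt⟪4, t⟫, d')} : Finset (Site 2 × Fin 2)), (pt⟪3, 2 * t + 1⟫, d)⟫ ∪
          Wev⟪({(pt⟪4, t⟫, d'), (pt⟪3, 2 * t + 1⟫, d)} : Finset (Site 2 × Fin 2)), (pt⟪2, 2 * t + 1⟫, d)⟫ ∪
          Wev⟪({(pt⟪4, t⟫, d'), (pt⟪3, 2 * t + 1⟫, d), (pt⟪2, 2 * t + 1⟫, d)} : Finset (Site 2 × Fin 2)),
            (pt⟪2, t⟫, d')⟫) ≤ 6 * (8000 * PS) := by
    intro t ht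
    obtain ⟨b1, b2, b3, b4, b5, b6⟩ := bound t ht
    set E1 := Wev⟪(∅ : Finset (Site 2 × Fin 2)), (pt⟪2, 2 * t + 1⟫, d)⟫ with hE1
    set E2 := Wev⟪({(pt⟪2, 2 * t + 1⟫, d)} : Finset (Site 2 × Fin 2)), (pt⟪2, t⟫, d')⟫ with hE2
    set E3 := Wev⟪(∅ : Finset (Site 2 × Fin 2)), (pt⟪4, t⟫, d')⟫ with hE3
    set E4 := Wev⟪({(pt⟪4, t⟫, d')} : Finset (Site 2 × Fin 2)), (pt⟪3, 2 * t + 1⟫, d)⟫ with hE4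
    set E5 := Wev⟪({(pt⟪4, t⟫, d'), (pt⟪3, 2 * t + 1⟫, d)} : Finset (Site 2 × Fin 2)), (pt⟪2, 2 * t + 1⟫, d)⟫
      with hE5
    set E6 := Wev⟪({(pt⟪4, t⟫, d'), (pt⟪3, 2 * t + 1⟫, d), (pt⟪2, 2 * t + 1⟫, d)} : Finset (Site 2 × Fin 2)),
      (pt⟪2, t⟫, d')⟫ with hE6
    have u1 := measureReal_union_le (μ := P) (E1 ∪ E2 ∪ E3 ∪ E4 ∪ E5) E6
    have u2 := measureReal_union_le (μ := P) (E1 ∪ E2 ∪ E3 ∪ E4) E5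
    have u3 := measureReal_union_le (μ := P) (E1 ∪ E2 ∪ E3) E4
    have u4 := measureReal_union_le (μ := P) (E1 ∪ E2) E3
    have u5 := measureReal_union_le (μ := P) E1 E2
    linarith
  have s0 := six 0 (Or.inl rfl)
  have s1 := six (-1) (Or.inr rfl)
  linarith

/-- **The middle atom.** -/
theorem real_atom_m_le (hd : d' ≠ d) (hρ0 : 0 ≤ ρ) (hρ1 : ρ ≤ 1) (hc : 1 / 10 ≤ c) (hc1 : c ≤ 1)
    (hbox : ∀ j : ℤ, 0 ≤ j → j ≤ 3 → pt⟪j, 0⟫ ∈ Bx) (hrow : pt⟪0, 1⟫ ∈ Bx ∨ pt⟪0, -1⟫ ∈ Bx) :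
    (P).real (Z⟪Tl, {(pt⟪1, 0⟫, d)}⟫ \ Z⟪Tl, (∅ : Set (Site 2 × Fin 2))⟫) ≤
      6 * 8000 * ∑ g' ∈ Πf, (P).real Piv⟪g'⟫ := by
  set PS := ∑ g' ∈ Πf, (P).real Piv⟪g'⟫ with hPS
  have hPS0 : 0 ≤ PS := Finset.sum_nonneg fun _ _ => measureReal_nonneg
  have key : ∀ S ∈ Z⟪Tl, {(pt⟪1, 0⟫, d)}⟫ \ Z⟪Tl, (∅ : Set (Site 2 × Fin 2))⟫,
      ∃ t : ℤ, (t = 0 ∨ t = -1) ∧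
        (S ∈ Wev⟪(∅ : Finset (Site 2 × Fin 2)), (pt⟪1, t⟫, d')⟫ ∨
          S ∈ Wev⟪({(pt⟪1, t⟫, d')} : Finset (Site 2 × Fin 2)), (pt⟪1, 2 * t + 1⟫, d)⟫ ∨
          S ∈ Wev⟪({(pt⟪1, t⟫, d'), (pt⟪1, 2 * t + 1⟫, d)} : Finset (Site 2 × Fin 2)), (pt⟪2, t⟫, d')⟫) := by
    rintro S ⟨hyes, hno⟩
    have hno' : ¬ Cr⟪Op⟪S⟫ \ Tl⟫ := by
      intro h; apply hno
      show Cr⟪(Op⟪S⟫ \ Tl) ∪ ∅⟫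
      rw [Set.union_empty]; exact h
    obtain ⟨t, s, ht, hs, hdisj⟩ := atom_m hd (V := Op⟪S⟫ \ Tl) hbox hrow hno' hyes
    subst hs
    refine ⟨t, ht, ?_⟩
    rcases hdisj with ⟨h1, h2⟩ | ⟨h1, h2⟩ | ⟨h1, h2⟩
    · exact Or.inl (mem_walkEvent h1 h2 sub0 sub0')
    · exact Or.inr (Or.inl (mem_walkEvent h1 h2 sub1 sub1'))
    · exact Or.inr (Or.inr (mem_walkEvent h1 h2 sub2 sub2'))
  have bound : ∀ t : ℤ, (t = 0 ∨ t = -1) →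
      (P).real (Wev⟪(∅ : Finset (Site 2 × Fin 2)), (pt⟪1, t⟫, d')⟫) ≤ 8000 * PS ∧
      (P).real (Wev⟪({(pt⟪1, t⟫, d')} : Finset (Site 2 × Fin 2)), (pt⟪1, 2 * t + 1⟫, d)⟫) ≤ 8000 * PS ∧
      (P).real (Wev⟪({(pt⟪1, t⟫, d'), (pt⟪1, 2 * t + 1⟫, d)} : Finset (Site 2 × Fin 2)), (pt⟪2, t⟫, d')⟫) ≤
        8000 * PS := by
    intro t ht
    have h3 : ¬ (3 : ℤ) ∣ 2 * t + 1 := by rcases ht with rfl | rfl <;> decide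
    have h1' : ¬ (3 : ℤ) ∣ 1 := by decide
    have h2' : ¬ (3 : ℤ) ∣ 2 := by decide
    have hf := not_axial_d' (b := b) hd t h1'
    have hx := not_axial_d (b := b) hd 1 h3
    have memPi : ∀ g : Site 2 × Fin 2,
        (g = (pt⟪1, t⟫, d') ∨ g = (pt⟪1, 2 * t + 1⟫, d) ∨ g = (pt⟪2, t⟫, d')) → g ∈ Πf := by
      intro g hg
      rcases ht with rfl | rfl <;>
        simp only [show (2 : ℤ) * 0 + 1 = 1 by norm_num, show (2 : ℤ) * (-1) + 1 = -1 by norm_num] at hg <;>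
        rcases hg with rfl | rfl | rfl <;>
        simp only [Finset.mem_insert, Finset.mem_singleton, true_or, or_true]
    have one : ∀ {O : Finset (Site 2 × Fin 2)} {g : Site 2 × Fin 2}, (∀ ℓ ∈ O, ¬ IsAxialEdge 3 ℓ) →
        O.card ≤ 3 → g ∉ O → (g = (pt⟪1, t⟫, d') ∨ g = (pt⟪1, 2 * t + 1⟫, d) ∨ g = (pt⟪2, t⟫, d')) →
        (P).real Wev⟪O, g⟫ ≤ 8000 * PS :=
      fun hO hO3 hgO hg => real_walkEvent_le_sum hd hρ0 hρ1 hc hc1 hO hO3 hgO (memPi _ hg)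
    have hxf : (pt⟪1, 2 * t + 1⟫, d) ≠ (pt⟪1, t⟫, d') := lab_ne_of_dir hd _ _ _ _
    have h2f : (pt⟪2, t⟫, d') ≠ (pt⟪1, t⟫, d') := by rw [Ne, lab_eq_iff hd]; omega
    have h2x : (pt⟪2, t⟫, d') ≠ (pt⟪1, 2 * t + 1⟫, d) := (lab_ne_of_dir hd _ _ _ _).symm
    refine ⟨?_, ?_, ?_⟩
    · exact one (by simp) (by simp) (by simp) (Or.inl rfl)
    · refine one (fun ℓ hℓ => ?_) (by simp) (by rwa [Finset.mem_singleton]) (Or.inr (Or.inl rfl))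
      rw [Finset.mem_singleton] at hℓ; rw [hℓ]; exact hf
    · refine one (fun ℓ hℓ => ?_) (Finset.card_le_two.trans (by norm_num)) ?_ (Or.inr (Or.inr rfl))
      · rw [Finset.mem_insert, Finset.mem_singleton] at hℓ
        rcases hℓ with rfl | rfl
        · exact hf
        · exact hx
      · rw [Finset.mem_insert, Finset.mem_singleton, not_or]; exact ⟨h2f, h2x⟩
  have hcover : Z⟪Tl, {(pt⟪1, 0⟫, d)}⟫ \ Z⟪Tl, (∅ : Set (Site 2 × Fin 2))⟫ ⊆
      (⋃ t ∈ ({0, -1} : Finset ℤ),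
        (Wev⟪(∅ : Finset (Site 2 × Fin 2)), (pt⟪1, t⟫, d')⟫ ∪
          Wev⟪({(pt⟪1, t⟫, d')} : Finset (Site 2 × Fin 2)), (pt⟪1, 2 * t + 1⟫, d)⟫ ∪
          Wev⟪({(pt⟪1, t⟫, d'), (pt⟪1, 2 * t + 1⟫, d)} : Finset (Site 2 × Fin 2)), (pt⟪2, t⟫, d')⟫)) := by
    intro S hS
    obtain ⟨t, ht, h⟩ := key S hS
    simp only [Set.mem_iUnion, Finset.mem_insert, Finset.mem_singleton, exists_prop]
    refine ⟨t, ht, ?_⟩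
    rcases h with h | h | h
    · exact Or.inl (Or.inl h)
    · exact Or.inl (Or.inr h)
    · exact Or.inr h
  refine (measureReal_mono hcover (measure_ne_top _ _)).trans ?_
  refine (measureReal_biUnion_finset_le _ _).trans ?_
  have h01 : (0 : ℤ) ≠ -1 := by decide
  rw [Finset.sum_insert (by simp [h01]), Finset.sum_singleton]
  have three : ∀ t : ℤ, (t = 0 ∨ t = -1) →
      (P).real (Wev⟪(∅ : Finset (Site 2 × Fin 2)), (pt⟪1, t⟫, d')⟫ ∪
          Wev⟪({(pt⟪1, t⟫, d')} : Finset (Site 2 × Fin 2)), (pt⟪1, 2 * t + 1⟫, d)⟫ ∪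
          Wev⟪({(pt⟪1, t⟫, d'), (pt⟪1, 2 * t + 1⟫, d)} : Finset (Site 2 × Fin 2)), (pt⟪2, t⟫, d')⟫) ≤
        3 * (8000 * PS) := by
    intro t ht
    obtain ⟨b1, b2, b3⟩ := bound t ht
    set E1 := Wev⟪(∅ : Finset (Site 2 × Fin 2)), (pt⟪1, t⟫, d')⟫ with hE1
    set E2 := Wev⟪({(pt⟪1, t⟫, d')} : Finset (Site 2 × Fin 2)), (pt⟪1, 2 * t + 1⟫, d)⟫ with hE2
    set E3 := Wev⟪({(pt⟪1, t⟫, d'), (pt⟪1, 2 * t + 1⟫, d)} : Finset (Site 2 × Fin 2)), (pt⟪2, t⟫, d')⟫ with hE3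
    have u1 := measureReal_union_le (μ := P) (E1 ∪ E2) E3
    have u2 := measureReal_union_le (μ := P) E1 E2
    linarith
  have s0 := three 0 (Or.inl rfl)
  have s1 := three (-1) (Or.inr rfl)
  linarith

/-- **The total atom bound.** With the tuple in the box and not inside a side, the probability
that one of its three sub-edges is an atom is at most `240000 · Σ_{g ∈ Π} P(g pivotal)`. -/
theorem real_atom_le (hd : d' ≠ d) (hρ0 : 0 ≤ ρ) (hρ1 : ρ ≤ 1) (hc : 1 / 10 ≤ c) (hc1 : c ≤ 1)
    (hbox : ∀ j : ℤ, 0 ≤ j → j ≤ 3 → pt⟪j, 0⟫ ∈ Bx) (hrow : pt⟪0, 1⟫ ∈ Bx ∨ pt⟪0, -1⟫ ∈ Bx)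
    (huR : pt⟪0, 0⟫ ∉ Rx)
    (huL : pt⟪0, 0⟫ ∈ Lx → ∀ s : ℤ, (s = 1 ∨ s = -1) → pt⟪0, s⟫ ∈ Bx → pt⟪0, s⟫ ∈ Lx)
    (hwL : pt⟪3, 0⟫ ∉ Lx)
    (hwR : pt⟪3, 0⟫ ∈ Rx → ∀ s : ℤ, (s = 1 ∨ s = -1) → pt⟪3, s⟫ ∈ Bx → pt⟪3, s⟫ ∈ Rx) :
    (P).real ((Z⟪Tl, {(pt⟪0, 0⟫, d)}⟫ ∪ Z⟪Tl, {(pt⟪1, 0⟫, d)}⟫ ∪ Z⟪Tl, {(pt⟪2, 0⟫, d)}⟫) \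
        Z⟪Tl, (∅ : Set (Site 2 × Fin 2))⟫) ≤ 240000 * ∑ g' ∈ Πf, (P).real Piv⟪g'⟫ := by
  have hu := real_atom_u_le (n := n) hd hρ0 hρ1 hc hc1 hbox hrow huR huL
  have hm := real_atom_m_le (n := n) hd hρ0 hρ1 hc hc1 hbox hrow
  have hw := real_atom_w_le (n := n) hd hρ0 hρ1 hc hc1 hbox hrow hwL hwR
  rw [Set.union_sdiff_distrib, Set.union_sdiff_distrib]
  have u1 := measureReal_union_le (μ := P)
    (Z⟪Tl, {(pt⟪0, 0⟫, d)}⟫ \ Z⟪Tl, (∅ : Set (Site 2 × Fin 2))⟫ ∪ Z⟪Tl, {(pt⟪1, 0⟫, d)}⟫ \ Z⟪Tl, (∅ : Set (Site 2 × Fin 2))⟫)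
    (Z⟪Tl, {(pt⟪2, 0⟫, d)}⟫ \ Z⟪Tl, (∅ : Set (Site 2 × Fin 2))⟫)
  have u2 := measureReal_union_le (μ := P)
    (Z⟪Tl, {(pt⟪0, 0⟫, d)}⟫ \ Z⟪Tl, (∅ : Set (Site 2 × Fin 2))⟫) (Z⟪Tl, {(pt⟪1, 0⟫, d)}⟫ \ Z⟪Tl, (∅ : Set (Site 2 × Fin 2))⟫)
  linarith

/-- The charge of a tuple is nonnegative. -/
theorem charge_nonneg : 0 ≤ ∑ g' ∈ Πf, (P).real Piv⟪g'⟫ :=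
  Finset.sum_nonneg fun _ _ => measureReal_nonneg

end Cone3

/-- **Registered sub-goal `stub_cone3_largeB` of stub `stub_cone3`** (`Cone3.charge_nonneg` with all local notations
expanded). -/
theorem stub_cone3_largeB : ∀ {n : ℕ} {ρ c : ℝ} {b : Site 2} {d d' : Fin 2}, 0 ≤ ∑ g' ∈ ({(((3 : ℤ) • b + (0 : ℤ) • (Pi.single d (1 : ℤ) : Site 2) + (1 : ℤ) • (Pi.single d' (1 : ℤ) : Site 2)), d), (((3 : ℤ) • b + (1 : ℤ) • (Pi.single d (1 : ℤ) : Site 2) + (0 : ℤ) • (Pi.single d' (1 : ℤ) : Site 2)), d'), (((3 : ℤ) • b + (-1 : ℤ) • (Pi.single d (1 : ℤ) : Site 2) + (0 : ℤ) • (Pi.single d' (1 : ℤ) : Site 2)), d'), (((3 : ℤ) • b + (-1 : ℤ) • (Pi.single d (1 : ℤ) : Site 2) + (1 : ℤ) • (Pi.single d' (1 : ℤ) : Site 2)), d), (((3 : ℤ) • b + (2 : ℤ) • (Pi.single d (1 : ℤ) : Site 2) + (1 : ℤ) • (Pi.single d' (1 : ℤ) : Site 2)), d), (((3 : ℤ)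 • b + (2 : ℤ) • (Pi.single d (1 : ℤ) : Site 2) + (0 : ℤ) • (Pi.single d' (1 : ℤ) : Site 2)), d'), (((3 : ℤ) • b + (4 : ℤ) • (Pi.single d (1 : ℤ) : Site 2) + (0 : ℤ) • (Pi.single d' (1 : ℤ) : Site 2)), d'), (((3 : ℤ) • b + (3 : ℤ) • (Pi.single d (1 : ℤ) : Site 2) + (1 : ℤ) • (Pi.single d' (1 : ℤ) : Site 2)), d), (((3 : ℤ) • b + (1 : ℤ) • (Pi.single d (1 : ℤ) : Site 2) + (1 : ℤ) • (Pi.single d' (1 : ℤ) : Site 2)), d), (((3 : ℤ) • b + (0 : ℤ) • (Pi.single d (1 : ℤ) : Site 2) + (-1 : ℤ) • (Pi.single d' (1 : ℤ) : Site 2)), d), (((3 : ℤ) • b + (1 : ℤ) • (Pi.single d (1 : ℤ) : Site 2) + (-1 : ℤ) • (Pi.single d' (1 : ℤ) : Site 2)), d'), (((3 : ℤ) • b + (-1 : ℤ) • (Pi.single d (1 : ℤ) : Site 2) + (-1 : ℤ) • (Pi.single d' (1 : ℤ) : Site 2)), d'), (((3 : ℤ) • b + (-1 : ℤ) • (Pi.single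 d (1 : ℤ) : Site 2) + (-1 : ℤ) • (Pi.single d' (1 : ℤ) : Site 2)), d), (((3 : ℤ) • b + (2 : ℤ) • (Pi.single d (1 : ℤ) : Site 2) + (-1 : ℤ) • (Pi.single d' (1 : ℤ) : Site 2)), d), (((3 : ℤ) • b + (2 : ℤ) • (Pi.single d (1 : ℤ) : Site 2) + (-1 : ℤ) • (Pi.single d' (1 : ℤ) : Site 2)), d'), (((3 : ℤ) • b + (4 : ℤ) • (Pi.single d (1 : ℤ) : Site 2) + (-1 : ℤ) • (Pi.single d' (1 : ℤ) : Site 2)), d'), (((3 : ℤ) • b + (3 : ℤ) • (Pi.single d (1 : ℤ) : Site 2) + (-1 : ℤ) • (Pi.single d' (1 : ℤ) : Site 2)), d), (((3 : ℤ) • b + (1 : ℤ) • (Pi.single d (1 : ℤ) : Site 2) + (-1 : ℤ) • (Pi.single d' (1 : ℤ) : Site 2)), d)} : Finset (Site 2 × Fin 2)), ((prodBernoulli (refinementParam 3 ρ c))).real ({S : Set (Site 2 × Fin 2 × Fin 3) | edgeConfig (({e : Site 2 × Fin 2 | RefinementOpen 3 S e} \ {g'}) ∪ {g'}) ∈ KST2023.crossing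 (3 * n) (3 * (3 * n))} \ {S : Set (Site 2 × Fin 2 × Fin 3) | edgeConfig (({e : Site 2 × Fin 2 | RefinementOpen 3 S e} \ {g'}) ∪ ∅) ∈ KST2023.crossing (3 * n) (3 * (3 * n))}) := by
  intro n ρ c b d d'
  exact Cone3.charge_nonneg 

end Summit.CriticalPhenomena.CardyFormulaZ2.Cruxes.CriticalPathRSW.FiniteSizeEnvelope

end
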